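import Summits.QuantumFields.YangMills.Theorems.BalabanUVNodesN12DirectSurjHsurjClosedForm
import Summits.QuantumFields.YangMills.Theorems.BalabanUVNodesN12NearFlatChartLetterBookkeeping

/-!
# BalabanUVNodes ∕ N12 — (P4)′ in closed form: the per-row ℓ¹ preimage letter `hrow` with `B₁ = h(d,L,k)·B` where `B` and the threshold `εH` are the CLOSED FORMS of
# `…HsurjClosedForm` in per-height binder constants — and the ℓ²(HS) instantiation of the local seminorm letter (`C_p = √(2d·L^{kd})`): NO torus bond count in any displayed value

Cell `pub-ymgap` (HUMAN RULINGS D-0062 ∕ D-0149), WIDTH SEAT `pub-ymgap-dag-n12-w6` g9 (node N12 = [B15]; key K1⁹ `stmt-QuantumFields-27364`, `--kind proof --supports … --as helper`;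
count-neutral).  THEOREMS ONLY (0 `def`, 0 `instance`, 0 `sorry`).  Lane word dag-n12-c g23 (2026-08-29): CLAIM-3 «closed-form display edition» GO (producer-side sibling; the ∃-statement
of p690734 that n12-d's v10.1 p691324 `choose`s over is untouched).

CONTENTS.  §1 the ℓ²(HS) seminorm `p₂(Y) = √(Σ_b ‖Y_b‖²)` as an admissible `p`: `l2Seminorm_le_sqrt_card_mul_norm_of_support` (`p₂(Y) ≤ √#S·‖Y‖` for `Y` vanishing off `S`),
`l2Seminorm_localLetter` (the LOCAL letter `hpT` with `C_p := √(2d·L^{kd})`), `l2Seminorm_ad_le` (`Ad`-invariance, for `exists_rowBound_p`'s `hpAd`).  §3 ★ `exists_constants_hrow_closedForm_l2` — NON-VACUITY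
at `p := ℓ²(HS)`: `∃ C₁ ρ₁ C₂ ρ₂ C_Φ Λ♭` (each from its producer of record) with the `hrow` letter at the DISPLAYED closed forms `εH(…)`, `B₁(…)` (p690734's `∃ ε ∃ B₁` sibling).  §2 ★★★ `exists_rightInverse_hrow_closedForm`
— `…HsurjClosedForm.exists_rightInverse_letter_support_closedForm`'s binders and instance hypotheses VERBATIM ⟹ `∃ H, hHinv ∧ (‖H v‖ ≤ B₁Σ‖v_i‖) ∧ (Σ_b‖H v b‖ ≤ B₁Σ‖v_i‖) ∧ hrow(B₁)`
with `B₁ := h(d,L,k)·(1+2C_Φ)(k+1)(1+(Λ♭+C₁ρ₁C_p+1)(1+2C_Φ))^{k+1}` written out, `h = 2d(k+1)(2d+1)^k·L^{kd}` (row-wise superposition + p689329's hull count, as in p690734).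

HONEST SCOPE.  U4-PARTIAL, as `…HsurjClosedForm`: `εH` and `B₁` are closed forms in the binder constants `C₁ ρ₁ C₂ ρ₂ C_Φ Λ♭` and `C_p` (= `√(2d·L^{kd})` for `p₂` by §1); those constants'
VALUES remain per-height compactness existentials over the torus's field space (U4 proper, uncommissioned); print's volume-free (46) NOT claimed.

HONEST FRAMING.  Bookkeeping by name over landed kernel theorems; nothing of Bałaban's asserted or refuted; N12 NOT discharged; K1⁹ NOT closed; count-neutral; R4 closes only the
conditional finite-`𝕋⁴` rung `BalabanLadder.UV`; no summit statement is proved here and NOT the Yang–Mills mass gap (Clay).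
-/

noncomputable section

open scoped BigOperators Matrix.Norms.L2Operator Topology NNReal
open Filter

namespace Summit.QuantumFields.YangMills.BalabanUVNodes.N12DirectSurjHullCountClosedForm

open Literature.MathematicalPhysics.QuantumFieldTheory.Balaban1983to89
open Node00 B15DeterminingSets
open T4Continuum (T4Family)
open BlockAveragingEMLLinearised (linAvg)
open T4AdjointCovarianceUnitary (lieSU)
open B14.Eq213DetSet (Bj maxDomT)
open B14.Eq213MaximalDomains (side)
open B14.Eq216Concrete (feeds)
open B5Eq118OneStroke (iterBlockOf)
open B15Eq112TorusCover (lift)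
open T4AxialGaugeSmallField (boxPlaqs)
open B16Ineq19NearFlatSliceNorms (opNorm_coe_le_norm_lieSU)
open Summit.QuantumFields.YangMills.BalabanUVNodes.N12NearFlatChartLetter (l2Seminorm_apply sum_opNorm_sq_le_l2Seminorm_sq)
open Summit.QuantumFields.YangMills.BalabanUVNodes.N12DirectSurjHsurjL1 (sum_norm_le_card_mul_norm_of_subset)
open Summit.QuantumFields.YangMills.BalabanUVNodes.N12DirectSurjHullCount (exists_rowHull_Bj)
open Summit.QuantumFields.YangMills.BalabanUVNodes.N12DirectSurjHsurjClosedForm (exists_rightInverse_letter_support_closedForm)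
open Summit.QuantumFields.YangMills.BalabanUVNodes.N12DirectSurjSiteBlockCurvedLocal (exists_rowBound_p exists_curved_siteBlock_local)
open Summit.QuantumFields.YangMills.BalabanUVNodes.N12DirectSurjHsurjSupportPrelim (exists_flatBlocks_uniform)
open Summit.QuantumFields.YangMills.BalabanUVNodes.N12DirectSurjHsurjUniformBPrelim (exists_flatDeriv_letter)

/-! ## §1  The ℓ²(HS) seminorm as an admissible `p` -/

section L2

variable {N : ℕ} {P : Params}

/-- `p₂(Y) ≤ √#S · ‖Y‖` for `Y` vanishing off the finset `S` (`p₂` = the junction's ℓ²(HS) seminorm, sup norm on the right). [cite: Balaban1985Averaging, (17)–(18) p.21 (bookkeeping)] -/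
theorem l2Seminorm_le_sqrt_card_mul_norm_of_support (Y : PBond P 0 → lieSU (Fin N)) (S : Finset (PBond P 0)) (hY : ∀ b, b ∉ S → Y b = 0) :
    (normSeminorm ℝ (PiLp 2 (fun _ : PBond P 0 => lieSU (Fin N)))).comp (WithLp.linearEquiv 2 ℝ (PBond P 0 → lieSU (Fin N))).symm.toLinearMap Y
      ≤ Real.sqrt (S.card) * ‖Y‖ := by
  classical
  rw [l2Seminorm_apply]
  have h1 : ∑ b, ‖Y b‖ ^ 2 = ∑ b ∈ S, ‖Y b‖ ^ 2 :=
    (Finset.sum_subset (Finset.subset_univ S) fun b _ hb => by rw [hY b hb, norm_zero, sq, mul_zero]).symm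
  have h2 : ∑ b ∈ S, ‖Y b‖ ^ 2 ≤ (S.card : ℝ) * ‖Y‖ ^ 2 := by
    calc ∑ b ∈ S, ‖Y b‖ ^ 2 ≤ ∑ _b ∈ S, ‖Y‖ ^ 2 := Finset.sum_le_sum fun b _ => pow_le_pow_left₀ (norm_nonneg _) (norm_le_pi_norm Y b) 2
      _ = (S.card : ℝ) * ‖Y‖ ^ 2 := by rw [Finset.sum_const, nsmul_eq_mul]
  rw [h1]
  calc Real.sqrt (∑ b ∈ S, ‖Y b‖ ^ 2) ≤ Real.sqrt ((S.card : ℝ) * ‖Y‖ ^ 2) := Real.sqrt_le_sqrt h2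
    _ = Real.sqrt (S.card) * ‖Y‖ := by rw [Real.sqrt_mul (Nat.cast_nonneg _), Real.sqrt_sq (norm_nonneg _)]

/-- **THE LOCAL LETTER FOR `p₂`**: on fields supported on at most `2d·L^{kd}` bonds, `p₂ ≤ √(2d·L^{kd})·‖·‖` — the `hpT` of `…HsurjClosedForm` with `C_p := √(2d·L^{kd})`, free of the
torus bond count. [cite: Balaban1984PropagatorsI, (1.18) p.20 (bookkeeping)] -/
theorem l2Seminorm_localLetter (k : ℕ) (Y : PBond P 0 → lieSU (Fin N)) (S : Finset (PBond P 0)) (hY : ∀ b, b ∉ S → Y b = 0)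
    (hS : S.card ≤ 2 * P.d * (P.L ^ P.d) ^ k) :
    (normSeminorm ℝ (PiLp 2 (fun _ : PBond P 0 => lieSU (Fin N)))).comp (WithLp.linearEquiv 2 ℝ (PBond P 0 → lieSU (Fin N))).symm.toLinearMap Y
      ≤ Real.sqrt ((2 * P.d * (P.L ^ P.d) ^ k : ℕ) : ℝ) * ‖Y‖ :=
  (l2Seminorm_le_sqrt_card_mul_norm_of_support Y S hY).trans
    (mul_le_mul_of_nonneg_right (Real.sqrt_le_sqrt (by exact_mod_cast hS)) (norm_nonneg _))

/-- **`Ad`-INVARIANCE OF `p₂`**: `p₂(b ↦ Ad(g_b)Y_b) ≤ p₂(Y)` (indeed `=`; `Ad` is an isometry of `𝔰𝔲(N)`) — the `hpAd` of `…SiteBlockCurvedLocal.exists_rowBound_p`. [cite: Balaban1985Variational, (153) p.301 (bookkeeping)] -/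
theorem l2Seminorm_ad_le (g : PBond P 0 → SU N) (Y : PBond P 0 → lieSU (Fin N)) :
    (normSeminorm ℝ (PiLp 2 (fun _ : PBond P 0 => lieSU (Fin N)))).comp (WithLp.linearEquiv 2 ℝ (PBond P 0 → lieSU (Fin N))).symm.toLinearMap
        (fun b => T4AdjointCovarianceUnitary.specialUnitaryAd (g b) (Y b))
      ≤ (normSeminorm ℝ (PiLp 2 (fun _ : PBond P 0 => lieSU (Fin N)))).comp (WithLp.linearEquiv 2 ℝ (PBond P 0 → lieSU (Fin N))).symm.toLinearMap Y := by
  rw [l2Seminorm_apply, l2Seminorm_apply]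
  refine le_of_eq (congrArg Real.sqrt (Finset.sum_congr rfl fun b _ => ?_))
  rw [T4AdjointCovarianceUnitary.norm_specialUnitaryAd]

end L2

/-! ## §2  The per-row ℓ¹ preimage letter in closed form -/

section Record

variable {F : T4Family} {N : ℕ} [NeZero N] {K k : ℕ}

set_option maxHeartbeats 400000 in
/-- ★★★ **THE PER-ROW ℓ¹ PREIMAGE LETTER `hrow` IN CLOSED FORM.**  Under the binders and instance hypotheses of `…HsurjClosedForm.exists_rightInverse_letter_support_closedForm` VERBATIM
(letters `C₁ ρ₁ C₂ ρ₂ Φ C_Φ Λ♭`, seminorm `p` with local letter `C_p`; threshold `εH` in closed form): a right inverse `H` (row-wise superposition of the closed-form support edition's) with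
`‖H v‖ ≤ B₁Σ_i‖v_i‖`, `Σ_b‖H v b‖ ≤ B₁Σ_i‖v_i‖` and `∀ i, 1 ≤ level i → ∀ ξ, ∃ x, DΨ(0)x = e_i ξ ∧ Σ_b‖↑x_b‖_op ≤ B₁‖ξ‖`, where
`B₁ = 2d(k+1)(2d+1)^k L^{kd} · (1+2C_Φ)(k+1)(1+(Λ♭+C₁ρ₁C_p+1)(1+2C_Φ))^{k+1}` IS WRITTEN OUT. [cite: Balaban1985Variational, (45)–(46) p.285, (83) p.290; Balaban1988Convergent, (2.2) p.255, (2.10)-(2.13) pp.256-257; Balaban1987RG1, (0.4) p.253] -/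
theorem exists_rightInverse_hrow_closedForm (hkK : k + 1 ≤ (F.P K).m + (F.P K).K)
    -- the linearised averages `Q` (any family; only the letters below are used)
    (Q : (i : ℕ) → (PBond (F.P K) 0 → Matrix (Fin N) (Fin N) ℂ) → PBond (F.P K) i → Matrix (Fin N) (Fin N) ℂ)
    -- a seminorm `p` with a LOCAL sup-norm letter `C_p` (fields supported on ≤ 2d·L^{kd} bonds); the letters below tie `p`, `Q` to the chart
    (p : Seminorm ℝ (PBond (F.P K) 0 → lieSU (Fin N))) {Cp : ℝ} (hCp : 0 ≤ Cp)
    (hpT : ∀ (Y : PBond (F.P K) 0 → lieSU (Fin N)) (S : Finset (PBond (F.P K) 0)), (∀ b, b ∉ S → Y b = 0) →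
      S.card ≤ 2 * (F.P K).d * ((F.P K).L ^ (F.P K).d) ^ k → p Y ≤ Cp * ‖Y‖)
    -- the (δ₂)♯ row letter in `p`-form, constants `C₁ ρ₁` (`…SiteBlockCurvedLocal.exists_rowBound_p`)
    {C₁ ρ₁ : ℝ} (hC₁ : 0 ≤ C₁) (hρ₁ : 0 < ρ₁)
    (hRB :
        ∀ (𝔹 : DetSet (F.P K)) (_ : ∀ j, k < j → 𝔹 j = ∅) (_ : k ≤ (F.P K).m + (F.P K).K) (W : MSField (F.P K) (SU N)) (U₀ : GaugeField (F.P K) 0 (SU N))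
          (_ : AgreeOn 𝔹 (avgFamily (avOfRecord F N K) U₀) W) (_ : SmallBelow (avOfRecord F N K) k U₀) (i : Fin (constrCard 𝔹 k))
          (u : GaugeTransf (F.P K) 0 (SU N)) ⦃δ : ℝ⦄ (_ : 0 ≤ δ) (_ : δ < ρ₁)
          (_ : ∀ b₀ : PBond (F.P K) 0,
            (iterBlockOf (((constrEnum 𝔹 k).symm i).1 : ℕ) b₀.src = ((constrEnum 𝔹 k).symm i).2.1.src ∨
              iterBlockOf (((constrEnum 𝔹 k).symm i).1 : ℕ) b₀.src = ((constrEnum 𝔹 k).symm i).2.1.tgt) →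
            (iterBlockOf (((constrEnum 𝔹 k).symm i).1 : ℕ) b₀.tgt = ((constrEnum 𝔹 k).symm i).2.1.src ∨
              iterBlockOf (((constrEnum 𝔹 k).symm i).1 : ℕ) b₀.tgt = ((constrEnum 𝔹 k).symm i).2.1.tgt) →
            ‖((GaugeField.gaugeAct u U₀ b₀ : SU N) : Matrix (Fin N) (Fin N) ℂ) - 1‖ ≤ δ)
          {Λ₀ : ℝ} (_ : 0 ≤ Λ₀)
          (_ : ∀ Y, ‖fderiv ℝ (msChart F N K k 𝔹 (avgFamily (avOfRecord F N K) (1 : GaugeField (F.P K) 0 (SU N))) (1 : GaugeField (F.P K) 0 (SU N))) 0 Y‖ ≤ Λ₀ * ‖Y‖)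
          (X : PBond (F.P K) 0 → lieSU (Fin N)),
          ‖fderiv ℝ (msChart F N K k 𝔹 W U₀) 0 X i‖ ≤ Λ₀ * ‖X‖ + C₁ * δ * p X)
    -- the curved-site-block letter, constants `C₂ ρ₂` (`…SiteBlockCurvedLocal.exists_curved_siteBlock_local`)
    {C₂ ρ₂ : ℝ} (hC₂ : 0 ≤ C₂) (hρ₂ : 0 < ρ₂)
    (hblk :
        ∀ (𝔹 : DetSet (F.P K)) (_ : ∀ j, k < j → 𝔹 j = ∅) (_ : k ≤ (F.P K).m + (F.P K).K) (W : MSField (F.P K) (SU N)) (U₀ : GaugeField (F.P K) 0 (SU N))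
          (_ : AgreeOn 𝔹 (avgFamily (avOfRecord F N K) U₀) W) (_ : SmallBelow (avOfRecord F N K) k U₀)
          {n : ℕ} (hn : n + 1 ≤ k) (y' : Site (F.P K) (n + 1))
          (Φ : (PBond (F.P K) (n + 1) → lieSU (Fin N)) →ₗ[ℝ] (PBond (F.P K) 0 → lieSU (Fin N))) {CΦ : ℝ} (_ : 0 ≤ CΦ)
          (_ : ∀ (v : PBond (F.P K) (n + 1) → lieSU (Fin N)) (c : PBond (F.P K) (n + 1)), (c.src = y' ∨ c.tgt = y') →
            Q (n + 1) (fun b => (Φ v b : Matrix (Fin N) (Fin N) ℂ)) c = (v c : Matrix (Fin N) (Fin N) ℂ))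
          (_ : ∀ v, ‖Φ v‖ ≤ CΦ * ‖v‖)
          {Cp : ℝ} (_ : 0 ≤ Cp) (_ : ∀ v, p (Φ v) ≤ Cp * ‖Φ v‖)
          (u : GaugeTransf (F.P K) 0 (SU N)) ⦃δ : ℝ⦄ (_ : 0 ≤ δ) (_ : δ < ρ₂) (_ : C₂ * δ * (Cp * CΦ) ≤ 1 / 2)
          (_ : ∀ c : PBond (F.P K) (n + 1), (c.src = y' ∨ c.tgt = y') → ∀ b₀ : PBond (F.P K) 0,
            (iterBlockOf (n + 1) b₀.src = c.src ∨ iterBlockOf (n + 1) b₀.src = c.tgt) →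
            (iterBlockOf (n + 1) b₀.tgt = c.src ∨ iterBlockOf (n + 1) b₀.tgt = c.tgt) →
            ‖((GaugeField.gaugeAct u U₀ b₀ : SU N) : Matrix (Fin N) (Fin N) ℂ) - 1‖ ≤ δ),
        ∀ t : PBond (F.P K) (n + 1) → lieSU (Fin N),
          ∃ X : PBond (F.P K) 0 → lieSU (Fin N),
            (∀ (c : PBond (F.P K) (n + 1)) (hc : c ∈ bondsOf (𝔹 (n + 1))), (c.src = y' ∨ c.tgt = y') →
              fderiv ℝ (msChart F N K k 𝔹 W U₀) 0 X (constrEnum 𝔹 k ⟨⟨n + 1, Nat.lt_succ_of_le hn⟩, c, hc⟩) = t c) ∧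
            (∀ b : PBond (F.P K) 0, X b ≠ 0 → ∃ v, Φ v b ≠ 0) ∧
            ‖X‖ ≤ 2 * CΦ * ‖t‖)
    -- the flat site blocks and their letter `C_Φ` (`…HsurjSupportPrelim.exists_flatBlocks_uniform`)
    (Φf : (n : ℕ) → Site (F.P K) (n + 1) → ((PBond (F.P K) (n + 1) → lieSU (Fin N)) →ₗ[ℝ] (PBond (F.P K) 0 → lieSU (Fin N)))) {CΦ : ℝ} (hCΦ1 : 1 ≤ CΦ)
    (hCΦfn : ∀ (n : ℕ), n < k → ∀ (y : Site (F.P K) (n + 1)) v, ‖Φf n y v‖ ≤ CΦ * ‖v‖)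
    (hΦprops : ∀ (n : ℕ) (y : Site (F.P K) (n + 1)), n + 1 ≤ (F.P K).m + (F.P K).K →
        (∀ (v : PBond (F.P K) (n + 1) → lieSU (Fin N)) (c : PBond (F.P K) (n + 1)), (c.src = y ∨ c.tgt = y) →
            Q (n + 1) (fun b => (Φf n y v b : Matrix (Fin N) (Fin N) ℂ)) c = (v c : Matrix (Fin N) (Fin N) ℂ)) ∧
        (∀ v (b : PBond (F.P K) 0), Φf n y v b ≠ 0 → iterBlockOf (n + 1) b.src = y ∧ iterBlockOf (n + 1) b.tgt = y ∧ iterBlockOf n b.src ≠ iterBlockOf n b.tgt))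
    -- the flat-derivative letter `Λ♭` (`…HsurjUniformBPrelim.exists_flatDeriv_letter`)
    {Λf : ℝ} (hΛf0 : 0 ≤ Λf)
    (hΛf : ∀ (𝔹 : DetSet (F.P K)) (X : PBond (F.P K) 0 → lieSU (Fin N)),
      ‖fderiv ℝ (msChart F N K k 𝔹 (avgFamily (avOfRecord F N K) (1 : GaugeField (F.P K) 0 (SU N))) (1 : GaugeField (F.P K) 0 (SU N))) 0 X‖ ≤ Λf * ‖X‖) :
    ∀ (M₁ : ℕ) (_ : 1 ≤ M₁) (Z : Set (Site (F.P K) 0)) (_ : side (F.P K).L M₁ k ∣ (F.P K).sitesPerDir 0)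
      (W : MSField (F.P K) (SU N)) (U₀ : GaugeField (F.P K) 0 (SU N)),
        AgreeOn (Bj M₁ Z k) (avgFamily (avOfRecord F N K) U₀) W →
        (∀ i : Fin (constrCard (Bj M₁ Z k) k), ∃ U' : GaugeField (F.P K) 0 (SU N),
          (∀ b ∈ feeds (((constrEnum (Bj M₁ Z k) k).symm i).1 : ℕ) ((constrEnum (Bj M₁ Z k) k).symm i).2.1, U' b = U₀ b) ∧ SmallBelow (avOfRecord F N K) k U') →
        (∀ (j : ℕ), 1 ≤ j → j ≤ k → ∀ y : Site (F.P K) j, embIter j y ∈ maxDomT M₁ Z j → ∃ U' : GaugeField (F.P K) 0 (SU N),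
          (∀ c : PBond (F.P K) j, (c.src = y ∨ c.tgt = y) → ∀ b₀ : PBond (F.P K) 0,
            (iterBlockOf j b₀.src = c.src ∨ iterBlockOf j b₀.src = c.tgt) → (iterBlockOf j b₀.tgt = c.src ∨ iterBlockOf j b₀.tgt = c.tgt) → U' b₀ = U₀ b₀) ∧
          SmallBelow (avOfRecord F N K) k U') →
        (∀ (j : ℕ), 1 ≤ j → j ≤ k → ∀ y : Site (F.P K) j, embIter j y ∈ maxDomT M₁ Z j →
          PlaqSmallOn (boxPlaqs (P := F.P K) (j := 0)
            (fun κ => lift (F.P K) (embIter j y) κ - ((((F.P K).L ^ j : ℕ) : ℤ) + ((((F.P K).L ^ j - 1) / 2 : ℕ) : ℤ)))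
            (fun κ => lift (F.P K) (embIter j y) κ + ((((F.P K).L ^ j : ℕ) : ℤ) + ((((F.P K).L ^ j - 1) / 2 : ℕ) : ℤ))))
            (min (min ρ₁ ρ₂ / (2 * (((((F.P K).d - 1 : ℕ) : ℝ) * ((2 * ((F.P K).L ^ k + ((F.P K).L ^ k - 1) / 2) : ℕ) : ℝ)) + 1))) (1 / (4 * (((((F.P K).d - 1 : ℕ) : ℝ) * ((2 * ((F.P K).L ^ k + ((F.P K).L ^ k - 1) / 2) : ℕ) : ℝ)) + 1) * (C₂ + 1) * (Cp * CΦ + 1)))) U₀) →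
        ∃ H : (Fin (constrCard (Bj M₁ Z k) k) → lieSU (Fin N)) → PBond (F.P K) 0 → lieSU (Fin N),
          (∀ v, fderiv ℝ (msChart F N K k (Bj M₁ Z k) W U₀) 0 (H v) = v) ∧
          (∀ v, ‖H v‖ ≤ (((2 * (F.P K).d * (k + 1) * (2 * (F.P K).d + 1) ^ k * ((F.P K).L ^ (F.P K).d) ^ k : ℕ) : ℝ) * ((1 + 2 * CΦ) * ((k + 1 : ℕ) : ℝ) * (1 + (Λf + C₁ * ρ₁ * Cp + 1) * (1 + 2 * CΦ)) ^ (k + 1))) * ∑ i, ‖v i‖) ∧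
          (∀ v, ∑ b, ‖H v b‖ ≤ (((2 * (F.P K).d * (k + 1) * (2 * (F.P K).d + 1) ^ k * ((F.P K).L ^ (F.P K).d) ^ k : ℕ) : ℝ) * ((1 + 2 * CΦ) * ((k + 1 : ℕ) : ℝ) * (1 + (Λf + C₁ * ρ₁ * Cp + 1) * (1 + 2 * CΦ)) ^ (k + 1))) * ∑ i, ‖v i‖) ∧
          ∀ i : Fin (constrCard (Bj M₁ Z k) k), 1 ≤ ((((constrEnum (Bj M₁ Z k) k).symm i).1 : ℕ)) → ∀ ξ : lieSU (Fin N),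
            ∃ x : PBond (F.P K) 0 → lieSU (Fin N), fderiv ℝ (msChart F N K k (Bj M₁ Z k) W U₀) 0 x = Pi.single i ξ ∧
              ∑ b, ‖(x b : Matrix (Fin N) (Fin N) ℂ)‖ ≤ (((2 * (F.P K).d * (k + 1) * (2 * (F.P K).d + 1) ^ k * ((F.P K).L ^ (F.P K).d) ^ k : ℕ) : ℝ) * ((1 + 2 * CΦ) * ((k + 1 : ℕ) : ℝ) * (1 + (Λf + C₁ * ρ₁ * Cp + 1) * (1 + 2 * CΦ)) ^ (k + 1))) * ‖ξ‖ := by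
  classical
  have hk : k ≤ (F.P K).m + (F.P K).K := Nat.le_of_succ_le hkK
  intro M₁ hM1 Z hdiv W U₀ hU hprox hproxSite hplaq
  obtain ⟨H, hHinv, hHsup, -, hHsupp⟩ :=
    exists_rightInverse_letter_support_closedForm hkK Q p hCp hpT hC₁ hρ₁ hRB hC₂ hρ₂ hblk Φf hCΦ1 hCΦfn hΦprops hΛf0 hΛf M₁ hM1 Z hdiv W U₀ hU hprox hproxSite hplaq
  have hCΦ0 : 0 ≤ CΦ := zero_le_one.trans hCΦ1
  have hB0 : (0 : ℝ) ≤ ((1 + 2 * CΦ) * ((k + 1 : ℕ) : ℝ) * (1 + (Λf + C₁ * ρ₁ * Cp + 1) * (1 + 2 * CΦ)) ^ (k + 1)) := by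
    have hΛ : 0 ≤ Λf + C₁ * ρ₁ * Cp + 1 := by nlinarith [mul_nonneg (mul_nonneg hC₁ hρ₁.le) hCp]
    positivity
  generalize ((1 + 2 * CΦ) * ((k + 1 : ℕ) : ℝ) * (1 + (Λf + C₁ * ρ₁ * Cp + 1) * (1 + 2 * CΦ)) ^ (k + 1)) = B at hHsup hB0 ⊢
  set h : ℕ := 2 * (F.P K).d * (k + 1) * (2 * (F.P K).d + 1) ^ k * ((F.P K).L ^ (F.P K).d) ^ k with hh_def
  have h1 : (1 : ℝ) ≤ h := by
    have hd : 1 ≤ (F.P K).d := (F.P K).hd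
    have : 1 ≤ h := by
      rw [hh_def]
      calc 1 ≤ 2 * (F.P K).d * (k + 1) := by nlinarith
        _ ≤ 2 * (F.P K).d * (k + 1) * (2 * (F.P K).d + 1) ^ k := Nat.le_mul_of_pos_right _ (by positivity)
        _ ≤ 2 * (F.P K).d * (k + 1) * (2 * (F.P K).d + 1) ^ k * ((F.P K).L ^ (F.P K).d) ^ k := Nat.le_mul_of_pos_right _ (pow_pos (pow_pos (F.P K).L_pos _) _)
    exact_mod_cast this
  -- the one-row charges and their sup norms
  have hns : ∀ (v : Fin (constrCard (Bj M₁ Z k) k) → lieSU (Fin N)) (i : Fin (constrCard (Bj M₁ Z k) k)),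
      ‖Pi.single (M := fun _ => lieSU (Fin N)) i (v i)‖ ≤ ‖v i‖ := fun v i =>
    (pi_norm_le_iff_of_nonneg (norm_nonneg _)).2 fun i' => by
      by_cases hi : i' = i
      · subst hi; rw [Pi.single_eq_same]
      · rw [Pi.single_eq_of_ne hi, norm_zero]; exact norm_nonneg _
  -- each one-row summand: supported on the row's hull (≤ h bonds), sup norm ≤ B‖v_i‖
  have hrow : ∀ (v : Fin (constrCard (Bj M₁ Z k) k) → lieSU (Fin N)) (i : Fin (constrCard (Bj M₁ Z k) k)),
      ∑ b, ‖H (Pi.single i (v i)) b‖ ≤ h * (B * ‖v i‖) := by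
    intro v i
    obtain ⟨𝒮, T, hT, hTh, ha, hb⟩ := exists_rowHull_Bj (P := F.P K) hk M₁ Z i
    have hne : ∀ i', Pi.single (M := fun _ => lieSU (Fin N)) i (v i) i' ≠ 0 → i' = i := fun i' hi' => by
      by_contra hii
      exact hi' (Pi.single_eq_of_ne hii _)
    have hzero : ∀ b, b ∉ T → H (Pi.single i (v i)) b = 0 := fun b hbT =>
      hHsupp (Pi.single i (v i)) 𝒮 (fun b' hb' hv => ha b' hb' (hne _ hv))
        (fun j hj hjk c hc hc' y hy hin b₀ hs ht hf => hb j hj hjk c hc (hc'.imp (fun hv => hne _ hv) id) y hy hin b₀ hs ht hf)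
        b fun m hm => hbT (hT m b hm)
    calc ∑ b, ‖H (Pi.single i (v i)) b‖ ≤ (T.card : ℝ) * ‖H (Pi.single i (v i))‖ := sum_norm_le_card_mul_norm_of_subset _ T hzero
      _ ≤ h * (B * ‖v i‖) :=
          mul_le_mul (by exact_mod_cast hTh) ((hHsup _).trans (mul_le_mul_of_nonneg_left (hns v i) hB0)) (norm_nonneg _) (Nat.cast_nonneg _)
  have hsum1 : ∀ (i : Fin (constrCard (Bj M₁ Z k) k)) (ξ : lieSU (Fin N)), ∑ i', ‖Pi.single (M := fun _ => lieSU (Fin N)) i ξ i'‖ = ‖ξ‖ := fun i ξ => by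
    rw [Finset.sum_eq_single i (fun i' _ hi' => by rw [Pi.single_eq_of_ne hi', norm_zero]) (fun h => absurd (Finset.mem_univ i) h), Pi.single_eq_same]
  -- the row-wise superposition
  have hl1 : ∀ v : Fin (constrCard (Bj M₁ Z k) k) → lieSU (Fin N), ∑ b, ‖(∑ i, H (Pi.single i (v i))) b‖ ≤ h * B * ∑ i, ‖v i‖ := fun v =>
    calc ∑ b, ‖(∑ i, H (Pi.single i (v i))) b‖ = ∑ b, ‖∑ i, H (Pi.single i (v i)) b‖ := by simp_rw [Finset.sum_apply]
      _ ≤ ∑ b, ∑ i, ‖H (Pi.single i (v i)) b‖ := Finset.sum_le_sum fun b _ => norm_sum_le _ _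
      _ = ∑ i, ∑ b, ‖H (Pi.single i (v i)) b‖ := Finset.sum_comm
      _ ≤ ∑ i, h * (B * ‖v i‖) := Finset.sum_le_sum fun i _ => hrow v i
      _ = h * B * ∑ i, ‖v i‖ := by rw [Finset.mul_sum]; simp_rw [mul_assoc]
  refine ⟨fun v => ∑ i, H (Pi.single i (v i)), fun v => ?_, fun v => ?_, hl1, fun i _ ξ => ?_⟩
  · -- right inverse: `DΨ(0)` is linear
    rw [map_sum]
    simp_rw [hHinv]
    exact Finset.univ_sum_single v
  · -- sup letter (`B ≤ h·B`)
    calc ‖∑ i, H (Pi.single i (v i))‖ ≤ ∑ i, ‖H (Pi.single i (v i))‖ := norm_sum_le _ _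
      _ ≤ ∑ i, B * ‖v i‖ := Finset.sum_le_sum fun i _ => (hHsup _).trans (mul_le_mul_of_nonneg_left (hns v i) hB0)
      _ = B * ∑ i, ‖v i‖ := by rw [Finset.mul_sum]
      _ ≤ h * B * ∑ i, ‖v i‖ := by
          rw [mul_assoc]
          exact le_mul_of_one_le_left (mul_nonneg hB0 (Finset.sum_nonneg fun i _ => norm_nonneg (v i))) h1
  · -- the per-row letter: `x := H′ (e_i ξ)`, operator norm ≤ Hilbert–Schmidt norm, `Σ_{i'} ‖(e_i ξ) i'‖ = ‖ξ‖`
    refine ⟨∑ i', H (Pi.single i' (Pi.single (M := fun _ => lieSU (Fin N)) i ξ i')), ?_, ?_⟩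
    · rw [map_sum]
      simp_rw [hHinv]
      exact Finset.univ_sum_single _
    · calc ∑ b, ‖((((∑ i', H (Pi.single i' (Pi.single (M := fun _ => lieSU (Fin N)) i ξ i'))) b : lieSU (Fin N)) : Matrix (Fin N) (Fin N) ℂ))‖
          ≤ ∑ b, ‖(∑ i', H (Pi.single i' (Pi.single (M := fun _ => lieSU (Fin N)) i ξ i'))) b‖ := Finset.sum_le_sum fun b _ => opNorm_coe_le_norm_lieSU _
        _ ≤ h * B * ∑ i', ‖Pi.single (M := fun _ => lieSU (Fin N)) i ξ i'‖ := hl1 _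
        _ = h * B * ‖ξ‖ := by rw [hsum1]

/-! ## §3  Non-vacuity at `p := ℓ²(HS)`: the letter with its constants' provenance and the closed forms displayed -/

/-- ★ **THE BINDERS ARE INHABITED, CLOSED FORMS DISPLAYED** — at `p := ℓ²(HS)`, `C_p := √(2d·L^{kd})` (§1): there EXIST per-height constants `C₁ ρ₁` (`exists_rowBound_p`), `C₂ ρ₂`
(`exists_curved_siteBlock_local`), `C_Φ` (`exists_flatBlocks_uniform`), `Λ♭` (`exists_flatDeriv_letter`) such that the `hrow` letter holds with the threshold
`εH = min (min ρ₁ ρ₂∕(2(D+1))) (1∕(4(D+1)(C₂+1)(C_p C_Φ+1)))` and `B₁ = h(d,L,k)·(1+2C_Φ)(k+1)(1+(Λ♭+C₁ρ₁C_p+1)(1+2C_Φ))^{k+1}` WRITTEN OUT in those constants (p690734's letter hides both behind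
`∃ ε ∃ B₁`; this is its closed-form sibling, every binder of §2 discharged by its producer of record). [cite: Balaban1985Variational, (45)–(46) p.285, (83) p.290; Balaban1988Convergent, (2.10)-(2.13) pp.256-257] -/
theorem exists_constants_hrow_closedForm_l2 (hkK : k + 1 ≤ (F.P K).m + (F.P K).K) :
    ∃ C₁ ρ₁ C₂ ρ₂ CΦ Λf : ℝ, 0 ≤ C₁ ∧ 0 < ρ₁ ∧ 0 ≤ C₂ ∧ 0 < ρ₂ ∧ 1 ≤ CΦ ∧ 0 ≤ Λf ∧
      ∀ (M₁ : ℕ) (_ : 1 ≤ M₁) (Z : Set (Site (F.P K) 0)) (_ : side (F.P K).L M₁ k ∣ (F.P K).sitesPerDir 0)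
      (W : MSField (F.P K) (SU N)) (U₀ : GaugeField (F.P K) 0 (SU N)),
        AgreeOn (Bj M₁ Z k) (avgFamily (avOfRecord F N K) U₀) W →
        (∀ i : Fin (constrCard (Bj M₁ Z k) k), ∃ U' : GaugeField (F.P K) 0 (SU N),
          (∀ b ∈ feeds (((constrEnum (Bj M₁ Z k) k).symm i).1 : ℕ) ((constrEnum (Bj M₁ Z k) k).symm i).2.1, U' b = U₀ b) ∧ SmallBelow (avOfRecord F N K) k U') →
        (∀ (j : ℕ), 1 ≤ j → j ≤ k → ∀ y : Site (F.P K) j, embIter j y ∈ maxDomT M₁ Z j → ∃ U' : GaugeField (F.P K) 0 (SU N),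
          (∀ c : PBond (F.P K) j, (c.src = y ∨ c.tgt = y) → ∀ b₀ : PBond (F.P K) 0,
            (iterBlockOf j b₀.src = c.src ∨ iterBlockOf j b₀.src = c.tgt) → (iterBlockOf j b₀.tgt = c.src ∨ iterBlockOf j b₀.tgt = c.tgt) → U' b₀ = U₀ b₀) ∧
          SmallBelow (avOfRecord F N K) k U') →
        (∀ (j : ℕ), 1 ≤ j → j ≤ k → ∀ y : Site (F.P K) j, embIter j y ∈ maxDomT M₁ Z j →
          PlaqSmallOn (boxPlaqs (P := F.P K) (j := 0)
            (fun κ => lift (F.P K) (embIter j y) κ - ((((F.P K).L ^ j : ℕ) : ℤ) + ((((F.P K).L ^ j - 1) / 2 : ℕ) : ℤ)))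
            (fun κ => lift (F.P K) (embIter j y) κ + ((((F.P K).L ^ j : ℕ) : ℤ) + ((((F.P K).L ^ j - 1) / 2 : ℕ) : ℤ))))
            (min (min ρ₁ ρ₂ / (2 * (((((F.P K).d - 1 : ℕ) : ℝ) * ((2 * ((F.P K).L ^ k + ((F.P K).L ^ k - 1) / 2) : ℕ) : ℝ)) + 1))) (1 / (4 * (((((F.P K).d - 1 : ℕ) : ℝ) * ((2 * ((F.P K).L ^ k + ((F.P K).L ^ k - 1) / 2) : ℕ) : ℝ)) + 1) * (C₂ + 1) * ((Real.sqrt ((2 * (F.P K).d * ((F.P K).L ^ (F.P K).d) ^ k : ℕ) : ℝ)) * CΦ + 1)))) U₀) →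
        ∃ H : (Fin (constrCard (Bj M₁ Z k) k) → lieSU (Fin N)) → PBond (F.P K) 0 → lieSU (Fin N),
          (∀ v, fderiv ℝ (msChart F N K k (Bj M₁ Z k) W U₀) 0 (H v) = v) ∧
          (∀ v, ‖H v‖ ≤ (((2 * (F.P K).d * (k + 1) * (2 * (F.P K).d + 1) ^ k * ((F.P K).L ^ (F.P K).d) ^ k : ℕ) : ℝ) * ((1 + 2 * CΦ) * ((k + 1 : ℕ) : ℝ) * (1 + (Λf + C₁ * ρ₁ * (Real.sqrt ((2 * (F.P K).d * ((F.P K).L ^ (F.P K).d) ^ k : ℕ) : ℝ)) + 1) * (1 + 2 * CΦ)) ^ (k + 1))) * ∑ i, ‖v i‖) ∧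
          (∀ v, ∑ b, ‖H v b‖ ≤ (((2 * (F.P K).d * (k + 1) * (2 * (F.P K).d + 1) ^ k * ((F.P K).L ^ (F.P K).d) ^ k : ℕ) : ℝ) * ((1 + 2 * CΦ) * ((k + 1 : ℕ) : ℝ) * (1 + (Λf + C₁ * ρ₁ * (Real.sqrt ((2 * (F.P K).d * ((F.P K).L ^ (F.P K).d) ^ k : ℕ) : ℝ)) + 1) * (1 + 2 * CΦ)) ^ (k + 1))) * ∑ i, ‖v i‖) ∧
          ∀ i : Fin (constrCard (Bj M₁ Z k) k), 1 ≤ ((((constrEnum (Bj M₁ Z k) k).symm i).1 : ℕ)) → ∀ ξ : lieSU (Fin N),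
            ∃ x : PBond (F.P K) 0 → lieSU (Fin N), fderiv ℝ (msChart F N K k (Bj M₁ Z k) W U₀) 0 x = Pi.single i ξ ∧
              ∑ b, ‖(x b : Matrix (Fin N) (Fin N) ℂ)‖ ≤ (((2 * (F.P K).d * (k + 1) * (2 * (F.P K).d + 1) ^ k * ((F.P K).L ^ (F.P K).d) ^ k : ℕ) : ℝ) * ((1 + 2 * CΦ) * ((k + 1 : ℕ) : ℝ) * (1 + (Λf + C₁ * ρ₁ * (Real.sqrt ((2 * (F.P K).d * ((F.P K).L ^ (F.P K).d) ^ k : ℕ) : ℝ)) + 1) * (1 + 2 * CΦ)) ^ (k + 1))) * ‖ξ‖ := by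
  classical
  obtain ⟨Q, hQ0, hQs⟩ : ∃ Q : (i : ℕ) → (PBond (F.P K) 0 → Matrix (Fin N) (Fin N) ℂ) → PBond (F.P K) i → Matrix (Fin N) (Fin N) ℂ,
      (∀ Y, Q 0 Y = Y) ∧ ∀ (i : ℕ) (Y : PBond (F.P K) 0 → Matrix (Fin N) (Fin N) ℂ) (c : PBond (F.P K) (i + 1)), Q (i + 1) Y c = linAvg (Q i Y) c :=
    ⟨fun i => Nat.rec (motive := fun i => (PBond (F.P K) 0 → Matrix (Fin N) (Fin N) ℂ) → PBond (F.P K) i → Matrix (Fin N) (Fin N) ℂ) (fun Y => Y)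
      (fun _ Qi Y c => linAvg (Qi Y) c) i, fun _ => rfl, fun _ _ _ => rfl⟩
  have hp : ∀ Y : PBond (F.P K) 0 → lieSU (Fin N), ∑ b, ‖(Y b : Matrix (Fin N) (Fin N) ℂ)‖ ^ 2 ≤
      (normSeminorm ℝ (PiLp 2 (fun _ : PBond (F.P K) 0 => lieSU (Fin N)))).comp (WithLp.linearEquiv 2 ℝ (PBond (F.P K) 0 → lieSU (Fin N))).symm.toLinearMap Y ^ 2 :=
    fun Y => sum_opNorm_sq_le_l2Seminorm_sq Y
  obtain ⟨C₁, ρ₁, hC₁, hρ₁, hRB⟩ := exists_rowBound_p (F := F) (N := N) (K := K) k Q hQ0 hQs _ hp (l2Seminorm_ad_le (P := F.P K))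
  obtain ⟨C₂, ρ₂, hC₂, hρ₂, hblk⟩ := exists_curved_siteBlock_local (F := F) (N := N) (K := K) k Q hQ0 hQs _ hp
  obtain ⟨Φf, CΦ, hCΦ1, hCΦfn, hΦprops⟩ := exists_flatBlocks_uniform (F := F) (N := N) (K := K) k Q hQ0 hQs
  obtain ⟨Λf, hΛf0, hΛf⟩ := exists_flatDeriv_letter (F := F) (N := N) K k
  have hCp : 0 ≤ (Real.sqrt ((2 * (F.P K).d * ((F.P K).L ^ (F.P K).d) ^ k : ℕ) : ℝ)) := Real.sqrt_nonneg _
  exact ⟨C₁, ρ₁, C₂, ρ₂, CΦ, Λf, hC₁, hρ₁, hC₂, hρ₂, hCΦ1, hΛf0, fun M₁ hM1 Z hdiv W U₀ hU hprox hproxSite hplaq =>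
    exists_rightInverse_hrow_closedForm hkK Q _ hCp (l2Seminorm_localLetter (P := F.P K) k) hC₁ hρ₁ hRB hC₂ hρ₂ hblk Φf hCΦ1 hCΦfn hΦprops hΛf0 hΛf
      M₁ hM1 Z hdiv W U₀ hU hprox hproxSite hplaq⟩

end Record

end Summit.QuantumFields.YangMills.BalabanUVNodes.N12DirectSurjHullCountClosedForm

end
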